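import Summits.BirchSwinnertonDyer.BirchSwinnertonDyer.Theorems.ResidualThetaTransportAtTwoSignedMuVanishingAtTwoPlusCuspSpanMersenne
import Summits.BirchSwinnertonDyer.BirchSwinnertonDyer.Theorems.ResidualThetaTransportAtTwoSignedMuVanishingAtTwoPlusLineV46
import HarnessLib

/-!
# Route `ResidualThetaTransportAtTwo`, crux Kμ⁺ `SignedMuVanishingAtTwoPlus` (stmt-BirchSwinnertonDyer-20689), line `birth`:
# the MERSENNE REDUCTION keyed to the route items BY NAME (item 27436 `CuspSpanEvenAtTwoOdd`, child 21437, the crux)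

Cell `bsd-wall`, width seat `bsd-wall-rtt-p4-w2` (g6). THEOREMS ONLY (no `def`, no named fact, no `sorry`); helper `--supports` the crux;
closes nothing; BSD is not proved by this. The route-independent part (chain arithmetic, `cuspSpanEvenAtTwo_of_mersenne`,
`cuspSpanEvenAtTwo_of_mersenne_gamma1`, upward poisoning) is `…CuspSpanMersenne`; this sequel only composes it with the landed by-name closers
of line `birth` (`…LineV46`, lead g7) and therefore sits in the cone of the route file.

* `cuspSpanEvenAtTwoOdd_of_mersenne` / `…_gamma1` — the ROUTE ITEM 27436 from the trace form (G″) (resp. the membership form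
  `Γ₁'(4^n − 1) ≤ M_{4^n−1}`) along the chain of levels `4^n − 1`, `n ≥ B`;
* `flatMuZeroAtTwo_of_mersenne` — the registered stub `FlatMuZeroAtTwo` of line `birth` (verbatim) from the chain;
* `signedMuAnalyticAtTwoPlus_of_abbesUllmo_of_mersenne`, `…_of_pub_of_mersenne` — the child 21437 from {Abbes–Ullmo | PUB⁵ item 27435} ∧ chain;
* `signedMuVanishingAtTwoPlus_of_seed_of_pub_of_mersenne` — the crux Kμ⁺ from {seed item 21438, PUB⁵ item 27435, chain}.

References: R. Pollack, Duke Math. J. 118 (2003) Conj. 6.3, Prop. 6.18 [Pollack2003]; A. Abbes, E. Ullmo, Compositio Math. 103 (1996) Thm. A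
[AbbesUllmo1996]; R. Greenberg, LNM 1716 (1999) Conj. 1.11 [Greenberg1999LNM]; A. W. Knapp, *Elliptic curves* (1992) Prop. 11.22 [Knapp1993].
-/

set_option autoImplicit false
-- justification: the `Summit.BirchSwinnertonDyer.BirchSwinnertonDyer.…` path repeats a component (route-file convention)
set_option linter.dupNamespace false

noncomputable section

open scoped Classical MatrixGroups ModularForm

open CongruenceSubgroup WeierstrassCurve Literature.NumberTheory.EllipticCurves
  Literature.NumberTheory.EllipticCurves.ModularForms Literature.NumberTheory.EllipticCurves.Rank1Residual
  Literature.NumberTheory.IwasawaTheory Summit.BirchSwinnertonDyer.Rank1Residual.Supersingular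
  Summit.BirchSwinnertonDyer.BirchSwinnertonDyer.Theses.ResidualThetaTransportAtTwo

namespace Summit.BirchSwinnertonDyer.BirchSwinnertonDyer.Theorems.SignedMuAtTwo

/-! ## §1. Item 27436 by name from the chain -/

section Node

/-- **THE ROUTE ITEM 27436 `CuspSpanEvenAtTwoOdd` FROM THE CHAIN** (trace form at `4^n − 1` for all `n ≥ B`). Conditional; the
item is NOT closed by this. [cite: Pollack2003, Conj. 6.3] -/
theorem cuspSpanEvenAtTwoOdd_of_mersenne (B : ℕ)
    (hG : ∀ n : ℕ, B ≤ n → ∀ χ : Gamma0 (4 ^ n - 1) → ZMod 2,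
      (∀ γ δ : Gamma0 (4 ^ n - 1), χ (γ * δ) = χ γ + χ δ) →
      (∀ γ : Gamma0 (4 ^ n - 1), ((γ : SL(2, ℤ)) 0 0 + (γ : SL(2, ℤ)) 1 1).natAbs ≤ 2 → χ γ = 0) →
      (∀ γ : Gamma0 (4 ^ n - 1), (∃ k : ℕ, 1 ≤ k ∧ ((γ : SL(2, ℤ)) 1 1).natAbs = 4 ^ k) → χ γ = 0) →
      ∃ ψ : ZMod (4 ^ n - 1) → ZMod 2, (∀ x y : ZMod (4 ^ n - 1), IsUnit x → IsUnit y → ψ (x * y) = ψ x + ψ y) ∧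
        ∀ γ : Gamma0 (4 ^ n - 1), χ γ = ψ ((((γ : SL(2, ℤ)) 1 1 : ℤ) : ZMod (4 ^ n - 1)))) :
    CuspSpanEvenAtTwoOdd :=
  fun N _ hN ↦ (cuspSpanEvenAtTwo_iff N).mp (cuspSpanEvenAtTwo_of_mersenne B hG N hN)

/-- **Item 27436 from the chain, membership form.** [cite: Knapp1993, Prop. 11.22] [cite: Pollack2003, Conj. 6.3] -/
theorem cuspSpanEvenAtTwoOdd_of_mersenne_gamma1 (B : ℕ)
    (hM : ∀ n : ℕ, B ≤ n → ∀ [NeZero (4 ^ n - 1)], Gamma1' (4 ^ n - 1) ≤ Subgroup.closure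
      ({γ : Gamma0 (4 ^ n - 1) | ((γ : SL(2, ℤ)) 0 0 + (γ : SL(2, ℤ)) 1 1).natAbs ≤ 2} ∪
        {γ : Gamma0 (4 ^ n - 1) | ∃ k : ℕ, 1 ≤ k ∧ ((γ : SL(2, ℤ)) 1 1).natAbs = 4 ^ k} ∪
        {γ : Gamma0 (4 ^ n - 1) | ∃ g : Gamma0 (4 ^ n - 1), g * g = γ} ∪ commutatorSet (Gamma0 (4 ^ n - 1)))) :
    CuspSpanEvenAtTwoOdd :=
  fun N _ hN ↦ (cuspSpanEvenAtTwo_iff N).mp (cuspSpanEvenAtTwo_of_mersenne_gamma1 B hM N hN)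

end Node

/-! ## §3. Consequences for line `birth` BY NAME (stub, child 21437, crux Kμ⁺) -/

section Birth

/-- **The registered stub `FlatMuZeroAtTwo` (verbatim) from the chain.** [cite: Pollack2003, Conj. 6.3 and Prop. 6.18] -/
theorem flatMuZeroAtTwo_of_mersenne (B : ℕ)
    (hG : ∀ n : ℕ, B ≤ n → ∀ χ : Gamma0 (4 ^ n - 1) → ZMod 2,
      (∀ γ δ : Gamma0 (4 ^ n - 1), χ (γ * δ) = χ γ + χ δ) →
      (∀ γ : Gamma0 (4 ^ n - 1), ((γ : SL(2, ℤ)) 0 0 + (γ : SL(2, ℤ)) 1 1).natAbs ≤ 2 → χ γ = 0) →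
      (∀ γ : Gamma0 (4 ^ n - 1), (∃ k : ℕ, 1 ≤ k ∧ ((γ : SL(2, ℤ)) 1 1).natAbs = 4 ^ k) → χ γ = 0) →
      ∃ ψ : ZMod (4 ^ n - 1) → ZMod 2, (∀ x y : ZMod (4 ^ n - 1), IsUnit x → IsUnit y → ψ (x * y) = ψ x + ψ y) ∧
        ∀ γ : Gamma0 (4 ^ n - 1), χ γ = ψ ((((γ : SL(2, ℤ)) 1 1 : ℤ) : ZMod (4 ^ n - 1)))) :
    ∀ (W : WeierstrassCurve ℚ) [W.IsElliptic] [W.IsGloballyMinimal], ¬ W.HasCM → W.analyticRank = 0 →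
      GoodSS W 2 → W.frobeniusTrace 2 = 0 → W.Δ < 0 →
      ∀ [NeZero (W.conductorNorm ℤ)] (f : CuspForm (Gamma0 (W.conductorNorm ℤ)) 2), IsNewformOf W f →
      ∀ (Lplus Lminus : IwasawaAlgebra 2), IsPollackPair f 2 Lplus Lminus → ¬ PowerSeries.C (2 : ℤ_[2]) ∣ Lminus :=
  flatMuZeroAtTwo_of_cuspSpanEvenAtTwoOdd (cuspSpanEvenAtTwoOdd_of_mersenne B hG)

/-- **The analytic child 21437 `SignedMuAnalyticAtTwoPlus` from Abbes–Ullmo Thm A (print, by name) and the chain.**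
[cite: AbbesUllmo1996, Thm. A] [cite: Pollack2003, Conj. 6.3 and Prop. 6.18] -/
theorem signedMuAnalyticAtTwoPlus_of_abbesUllmo_of_mersenne
    (hAU : abbesUllmo_not_dvd_maninConstant_of_not_dvd_level) (B : ℕ)
    (hG : ∀ n : ℕ, B ≤ n → ∀ χ : Gamma0 (4 ^ n - 1) → ZMod 2,
      (∀ γ δ : Gamma0 (4 ^ n - 1), χ (γ * δ) = χ γ + χ δ) →
      (∀ γ : Gamma0 (4 ^ n - 1), ((γ : SL(2, ℤ)) 0 0 + (γ : SL(2, ℤ)) 1 1).natAbs ≤ 2 → χ γ = 0) →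
      (∀ γ : Gamma0 (4 ^ n - 1), (∃ k : ℕ, 1 ≤ k ∧ ((γ : SL(2, ℤ)) 1 1).natAbs = 4 ^ k) → χ γ = 0) →
      ∃ ψ : ZMod (4 ^ n - 1) → ZMod 2, (∀ x y : ZMod (4 ^ n - 1), IsUnit x → IsUnit y → ψ (x * y) = ψ x + ψ y) ∧
        ∀ γ : Gamma0 (4 ^ n - 1), χ γ = ψ ((((γ : SL(2, ℤ)) 1 1 : ℤ) : ZMod (4 ^ n - 1)))) :
    SignedMuAnalyticAtTwoPlus :=
  signedMuAnalyticAtTwoPlus_of_abbesUllmo_of_cuspSpanEvenAtTwoOdd hAU (cuspSpanEvenAtTwoOdd_of_mersenne B hG)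

/-- **The analytic child 21437 from the PUB⁵ item 27435 and the chain.** [cite: AbbesUllmo1996, Thm. A] -/
theorem signedMuAnalyticAtTwoPlus_of_pub_of_mersenne (hPub : PublishedInputsHeckeAtTwo) (B : ℕ)
    (hG : ∀ n : ℕ, B ≤ n → ∀ χ : Gamma0 (4 ^ n - 1) → ZMod 2,
      (∀ γ δ : Gamma0 (4 ^ n - 1), χ (γ * δ) = χ γ + χ δ) →
      (∀ γ : Gamma0 (4 ^ n - 1), ((γ : SL(2, ℤ)) 0 0 + (γ : SL(2, ℤ)) 1 1).natAbs ≤ 2 → χ γ = 0) →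
      (∀ γ : Gamma0 (4 ^ n - 1), (∃ k : ℕ, 1 ≤ k ∧ ((γ : SL(2, ℤ)) 1 1).natAbs = 4 ^ k) → χ γ = 0) →
      ∃ ψ : ZMod (4 ^ n - 1) → ZMod 2, (∀ x y : ZMod (4 ^ n - 1), IsUnit x → IsUnit y → ψ (x * y) = ψ x + ψ y) ∧
        ∀ γ : Gamma0 (4 ^ n - 1), χ γ = ψ ((((γ : SL(2, ℤ)) 1 1 : ℤ) : ZMod (4 ^ n - 1)))) :
    SignedMuAnalyticAtTwoPlus :=
  signedMuAnalyticAtTwoPlus_of_pub_of_cuspSpanEvenAtTwoOdd hPub (cuspSpanEvenAtTwoOdd_of_mersenne B hG)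

/-- **The crux Kμ⁺ `SignedMuVanishingAtTwoPlus` BY NAME from {seed item 21438, PUB⁵ item 27435, the chain}.** Conditional on two
open inputs and one print bundle; BSD is not proved by this. [cite: Greenberg1999LNM, Conj. 1.11] [cite: AbbesUllmo1996, Thm. A] -/
theorem signedMuVanishingAtTwoPlus_of_seed_of_pub_of_mersenne (hSeed : SignedMuSeedAtTwoPlus)
    (hPub : PublishedInputsHeckeAtTwo) (B : ℕ)
    (hG : ∀ n : ℕ, B ≤ n → ∀ χ : Gamma0 (4 ^ n - 1) → ZMod 2,
      (∀ γ δ : Gamma0 (4 ^ n - 1), χ (γ * δ) = χ γ + χ δ) →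
      (∀ γ : Gamma0 (4 ^ n - 1), ((γ : SL(2, ℤ)) 0 0 + (γ : SL(2, ℤ)) 1 1).natAbs ≤ 2 → χ γ = 0) →
      (∀ γ : Gamma0 (4 ^ n - 1), (∃ k : ℕ, 1 ≤ k ∧ ((γ : SL(2, ℤ)) 1 1).natAbs = 4 ^ k) → χ γ = 0) →
      ∃ ψ : ZMod (4 ^ n - 1) → ZMod 2, (∀ x y : ZMod (4 ^ n - 1), IsUnit x → IsUnit y → ψ (x * y) = ψ x + ψ y) ∧
        ∀ γ : Gamma0 (4 ^ n - 1), χ γ = ψ ((((γ : SL(2, ℤ)) 1 1 : ℤ) : ZMod (4 ^ n - 1)))) :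
    SignedMuVanishingAtTwoPlus :=
  signedMuVanishingAtTwoPlus_of_seed_of_pub_of_cuspSpanEvenAtTwoOdd hSeed hPub (cuspSpanEvenAtTwoOdd_of_mersenne B hG)

end Birth

end Summit.BirchSwinnertonDyer.BirchSwinnertonDyer.Theorems.SignedMuAtTwo

end
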